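import Literature.AlgebraicGeometry.HodgeTheory.SupportedHodgeClassesAlgebraic
import Literature.AlgebraicGeometry.HodgeTheory.HodgeModelExistence
import Literature.AlgebraicGeometry.HodgeTheory.ComplexOrientationFamily
import Literature.AlgebraicGeometry.HodgeTheory.AndreottiFrankelAffine
import Literature.AlgebraicGeometry.HodgeTheory.LefschetzOneOne
import Literature.AlgebraicTopology.SingularHomology.UniversalCoefficientsField
import Summits.HodgeConjecture.HodgeConjecture.Statement
import HarnessLib

/-!
# The Hodge conjecture is equivalent to "rational Hodge classes at and below the middle degree have
coniveau `≥ 1`" (solo seat `solo-HodgeConjecture-informed` → `Theorems/SoloInformedConiveauOne`)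

Let `X` be smooth projective of dimension `n` over `ℂ` and
`N¹ Hᵏ(X(ℂ); ℂ) = supportedClasses X k 1` the subspace of classes that vanish in `Hᵏ((X ∖ D)(ℂ); ℂ)`
for some Zariski-closed `D ⊊ X` (equivalently, for some divisor `D`; equivalently, classes that die
at the generic point of `X`). Write **C1(n, p)** for

  for every smooth projective `X/ℂ` of dimension `n` and every RATIONAL class `c ∈ H²ᵖ(X(ℂ); ℂ)` of
  Hodge type `(p, p)`: `c ∈ N¹ H²ᵖ(X(ℂ); ℂ)`,

the slice `(i, r) = (2p, 1)` of Grothendieck's amended generalized Hodge conjecture applied to the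
level-`0` sub-Hodge structure `ℚ · c` (Grothendieck 1969, pp. 300–301). It is typeable on the tree's
real carriers (no notion of sub-Hodge structure is needed for a line of level `0`).

## Results (sorry-free; conditional only on the tree's named published facts)

* `soloInformed_supportedClasses_one_eq_top_of_lt` — above the middle coniveau one is automatic:
  `N¹ Hᵏ(X(ℂ); ℂ) = Hᵏ(X(ℂ); ℂ)` for `k > n` (the complement of a non-empty affine open `U` is a
  closed `Z ⊊ X`, and `Hᵏ(U(ℂ); ℂ) = 0` for `k > n` by Andreotti–Frankel, tree theorem
  `AffineCoordinates.isZero_singularHomology_setOf_pt_mem_affineOpen`, and universal coefficients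
  over a field). Unconditional.
* `soloInformed_coniveauOne_of_hodgeConjecture` — `HC ⇒ C1(n, p)` for all `p ≥ 1` (`Nᵖ ⊆ N¹`).
  Unconditional.
* `soloInformed_hodgeClasses_algebraic_of_coniveauOne` — the engine: granted the named facts
  `Deligne1974_ker_restrictCompl_eq_iSup_range_complexGysin` (Deligne, Hodge III, Cor. 8.2.8),
  `Voisin2025_hodgeClass_lift_complexGysin` (semisimplicity lift of Hodge classes along Gysin maps,
  Voisin I Lemma 7.26 / Voisin 2025 Cor. 2.12), `gysinMap_restrictCompl_eq_zero ℂ` (Gysin maps vs.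
  restriction to opens, Fulton, Young Tableaux App. B Ex. 5), `Resolution.Hironaka1964_projective`
  (Kollár 2007 Thm. 3.27) and `lefschetzOneOne_rational` (Lefschetz `(1,1)`, Voisin I Thm. 11.30),
  the hypotheses `C1(m, p)` for all `m ≤ N`, `2 ≤ p`, `2p ≤ m` imply that every rational
  `(p,p)`-class on every smooth projective `X` of dimension `≤ N` is algebraic. PROOF: strong
  induction on `m = dim X`. A rational `(p,p)`-class, `p ≥ 1`, has coniveau `≥ 1` — automatically if
  `2p > m`, by Lefschetz `(1,1)` if `p = 1`, by hypothesis otherwise — so it dies off a closed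
  `Z ⊊ X`; by Deligne 8.2.8 and the semisimplicity lift (tree:
  `mem_iSup_map_complexGysin_of_restrictCompl_eq_zero_of_ne_univ`) it is a `ℂ`-combination of Gysin
  images `g_* b` along `g : W → X`, `W` smooth projective of dimension `m - e`, `1 ≤ e ≤ p`, `b`
  rational of type `(p - e, p - e)`; by induction `b` is algebraic on `W`, and Gysin images of
  algebraic classes are algebraic (tree: `map_complexGysin_algebraicClasses_le`). Base: `p = 0`
  (`algebraicClasses_zero`).
* `soloInformed_hodgeConjecture_iff_coniveauOne` — with `nonempty_hodgeModel` (Serre GAGA + de Rham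
  + Hodge decomposition: the anti-vacuity conjunct of `HodgeConjectureFor`) in addition:
  `HodgeConjecture ↔ ∀ n p, 2 ≤ p → 2p ≤ n → C1(n, p)`.
* `soloInformed_hodgeClasses_algebraic_of_dim_le_three` — corollary `N = 3` (no hypothesis left):
  the Hodge conjecture in dimension `≤ 3`, here WITHOUT hard Lefschetz.
* `soloInformed_hodgeClasses_algebraic_dim_le_four_iff_coniveauOne_two_two` — corollary `N = 4`:
  the Hodge conjecture for all smooth projective varieties of dimension `≤ 4` is equivalent to
  `C1(4, 2)`: every rational `(2,2)`-class on a smooth projective fourfold vanishes on the complex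
  points of the complement of some divisor. This is the first open case.

## Why this reformulation (solo PLAN, `run/shared/lean/ideation/HodgeConjecture/solo-informed/PLAN.md`)

It isolates the single primitive any proof of the Hodge conjecture must perform, one dimension at a
time and only at or below the middle degree: *make a rational `(p,p)`-class vanish on some affine
open subset* (kill it at the generic point). Everything else — descending the class to smaller
smooth projective varieties and recognising Gysin images of algebraic classes as algebraic — is
supplied by mixed Hodge theory (Deligne 8.2.8, semisimplicity of polarised Hodge structures) and is
already in the tree.

## References

* [GrothendieckTopology1969] A. Grothendieck, Hodge's general conjecture is false for trivial reasons,
  Topology 8 (1969) 299–303, pp. 300–301.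
* [DeligneHodgeIII1974] P. Deligne, Théorie de Hodge III, Publ. Math. IHÉS 44 (1974), Cor. 8.2.8.
* [Voisin2025] C. Voisin, Hodge and generalized Hodge conjectures, coniveau and algebraic cycles,
  J. Open Math. Probl. 1 (2025), §2 (Cor. 2.12).
* [VoisinHodgeII2003] C. Voisin, Hodge Theory and Complex Algebraic Geometry II (2003), Thm. 1.22
  (Andreotti–Frankel).
* [VoisinHodgeI2002] C. Voisin, Hodge Theory and Complex Algebraic Geometry I (2002), Thm. 11.30.
* [Jannsen1990MixedMotives] U. Jannsen, Mixed Motives and Algebraic K-Theory, LNM 1400 (1990), §7.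
* [Deligne2000] P. Deligne, The Hodge conjecture, Clay Mathematics Institute (2000), §1.
-/

noncomputable section

open CategoryTheory CategoryTheory.Limits AlgebraicGeometry
open Literature.AlgebraicTopology.SingularHomology
open Literature.AlgebraicGeometry Literature.AlgebraicGeometry.HodgeTheory

namespace Summit.HodgeConjecture.HodgeConjecture.Theorems

variable {n : ℕ} {X : Motives.SchemeOver ℂ}

/-! ### Unconditional lemmas -/

/-- In a smooth projective (hence irreducible) `X`, a subset all of whose points have codimension
`≥ 1` misses the generic point, so it is not everything. [cite: Hartshorne1977, II Ex. 3.20] -/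
theorem soloInformed_ne_univ_of_one_le_coheight (hX : Motives.IsSmoothProjective n X) {Z : Set X.left}
    (hrZ : ∀ z ∈ Z, (1 : ℕ∞) ≤ Order.coheight z) : Z ≠ Set.univ := by
  haveI := irreducibleSpace_of_isSmoothProjective' hX
  intro hZ
  have hη : (1 : ℕ∞) ≤ Order.coheight (genericPoint X.left) := hrZ _ (hZ ▸ Set.mem_univ _)
  rw [Order.one_le_iff_ne_zero, ne_eq, Order.coheight_eq_zero] at hη
  exact hη fun z _ ↦
    Scheme.le_iff_specializes.2 ((genericPoint_spec X.left).specializes (Set.mem_univ z))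

/-- **Above the middle degree coniveau one is automatic**: `N¹ Hᵏ(X(ℂ); ℂ) = Hᵏ(X(ℂ); ℂ)` for
`X` smooth projective of dimension `n` and `k > n`. Take a non-empty affine open `U ⊆ X` (one
containing the generic point); its complement `Z` is Zariski-closed, `≠ X`, so of codimension `≥ 1`
pointwise, and every class dies on `(X ∖ Z)(ℂ) ≃ₜ U(ℂ)` because `Hᵏ(U(ℂ); ℂ) = 0` for `k > n`
(Andreotti–Frankel for the smooth affine `n`-fold `U`, and universal coefficients over the field `ℂ`).
[cite: VoisinHodgeII2003, §1.2.2 Thm. 1.22] [cite: GrothendieckTopology1969, p. 300] -/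
theorem soloInformed_supportedClasses_one_eq_top_of_lt (hX : Motives.IsSmoothProjective n X) {k : ℕ}
    (hk : n < k) : supportedClasses X k 1 = ⊤ := by
  haveI := irreducibleSpace_of_isSmoothProjective' hX
  haveI := hX.smoothOfRelativeDimension
  haveI := locallyOfFiniteType_of_isSmoothProjective hX
  -- a non-empty affine open `U` (one containing the generic point) and its closed complement `Z`
  obtain ⟨U, hU, hηU, -⟩ := exists_isAffineOpen_mem_and_subset
    (show genericPoint X.left ∈ (⊤ : X.left.Opens) from trivial)
  set Z : Set X.left := (U : Set X.left)ᶜ with hZdef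
  have hZ : IsClosed Z := U.isOpen.isClosed_compl
  have hZ' : Z ≠ Set.univ := fun h ↦ (h ▸ Set.mem_univ (genericPoint X.left) : _ ∈ Z) hηU
  have hrZ : ∀ z ∈ Z, (1 : ℕ∞) ≤ Order.coheight z := fun z hz ↦
    one_le_coheight_of_mem_of_isClosed hX hZ hZ' hz
  refine eq_top_iff.2 fun x _ ↦ mem_supportedClasses_of_restrictCompl_eq_zero hZ
    (fun z hz ↦ by exact_mod_cast hrZ z hz) ?_
  -- `H_k` of the complex points over `U` vanishes (Andreotti–Frankel), `(X ∖ Z)(ℂ)` is that space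
  have hAF : IsZero (singularHomology ℂ ℂ
      ↥{P : Motives.ComplexPoints X | P.pt ∈ (U : Set X.left)} k) :=
    AffineCoordinates.isZero_singularHomology_setOf_pt_mem_affineOpen (n := n) X U hU (by omega)
  let e : Motives.complexPointsCompl X Z ≃ₜ ↥{P : Motives.ComplexPoints X | P.pt ∈ (U : Set X.left)} :=
    Homeomorph.setCongr (s := {P : Motives.ComplexPoints X | P.pt ∉ Z})
      (Set.ext fun P ↦ by simp [hZdef])
  have hH : IsZero (singularHomology ℂ ℂ (Motives.complexPointsCompl X Z) k) :=
    hAF.of_iso ((HomologicalComplex.homologyFunctor _ _ k).mapIso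
      (singularChainComplex.mapHomeomorph ℂ ℂ e))
  -- hence so does `Hᵏ` (universal coefficients over the field `ℂ`)
  haveI := ModuleCat.subsingleton_of_isZero hH
  haveI : Subsingleton (singularHomology ℂ ℂ (Motives.complexPointsCompl X Z) k →ₗ[ℂ] ℂ) :=
    ⟨fun f g ↦ LinearMap.ext fun y ↦ by rw [Subsingleton.elim y 0, map_zero, map_zero]⟩
  haveI : Subsingleton (singularCohomology ℂ ℂ (Motives.complexPointsCompl X Z) k) :=
    (kroneckerPairing_bijective_of_field ℂ (Motives.complexPointsCompl X Z) k).1.subsingleton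
  exact Subsingleton.elim _ _

/-- `HC ⇒ coniveau one`: an algebraic class of codimension `p ≥ 1` lies in `Nᵖ ⊆ N¹`
(`algebraicClasses X p = supportedClasses X (2p) p`; the support filtration is decreasing).
Unconditional. [cite: GrothendieckTopology1969, p. 299] -/
theorem soloInformed_coniveauOne_of_hodgeConjecture (h : _root_.HodgeConjecture) :
    ∀ ⦃n : ℕ⦄ ⦃X : Motives.SchemeOver ℂ⦄, Motives.IsSmoothProjective n X →
      ∀ (p : ℕ) (c : complexBetti X (2 * p)), 1 ≤ p → IsRationalClass c →
        IsOfHodgeType n X (2 * p) p p c → c ∈ supportedClasses X (2 * p) 1 := by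
  intro n X hX p c hp hc hc'
  exact supportedClasses_mono X (2 * p) hp ((h hX).2 p c hc hc')

/-! ### The engine: coniveau one at and below the middle ⇒ Hodge classes are algebraic -/

/-- **Coniveau one at and below the middle degree implies the Hodge conjecture, dimension by
dimension** (granted the tree's named facts: Deligne 8.2.8, the semisimplicity lift of Hodge
classes along Gysin maps, Gysin maps vs. restriction, projective Hironaka, Lefschetz `(1,1)`).
If every rational `(p,p)`-class with `2 ≤ p`, `2p ≤ m` on every smooth projective `m`-fold,
`m ≤ N`, has coniveau `≥ 1`, then every rational `(p,p)`-class on every smooth projective variety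
of dimension `≤ N` is algebraic. Strong induction on the dimension: a rational `(p,p)`-class with
`p ≥ 1` has coniveau `≥ 1` (automatic above the middle, `soloInformed_supportedClasses_one_eq_top_of_lt`;
Lefschetz `(1,1)` for `p = 1`; the hypothesis otherwise), hence is a `ℂ`-combination of Gysin
images `g_* b`, `g : W → X`, `W` smooth projective of dimension `m - e`, `1 ≤ e ≤ p`, `b` rational
of type `(p - e, p - e)` (tree: `mem_iSup_map_complexGysin_of_restrictCompl_eq_zero_of_ne_univ`);
by induction `b ∈ algebraicClasses W (p - e)`, and `g_*` maps algebraic classes to algebraic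
classes (tree: `map_complexGysin_algebraicClasses_le`). Base `p = 0`: `algebraicClasses_zero`.
[cite: GrothendieckTopology1969, p. 300] [cite: DeligneHodgeIII1974, Cor. 8.2.8]
[cite: Voisin2025, Cor. 2.12] [cite: VoisinHodgeI2002, Thm. 11.30] -/
theorem soloInformed_hodgeClasses_algebraic_of_coniveauOne
    (hA : Deligne1974_ker_restrictCompl_eq_iSup_range_complexGysin)
    (hB : Voisin2025_hodgeClass_lift_complexGysin)
    (hS : gysinMap_restrictCompl_eq_zero.{0, 0} ℂ)
    (hH : Resolution.Hironaka1964_projective.{0})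
    (hL : lefschetzOneOne_rational) {N : ℕ}
    (h1 : ∀ ⦃m : ℕ⦄ ⦃X : Motives.SchemeOver ℂ⦄, m ≤ N → Motives.IsSmoothProjective m X →
      ∀ (p : ℕ) (c : complexBetti X (2 * p)), 2 ≤ p → 2 * p ≤ m → IsRationalClass c →
        IsOfHodgeType m X (2 * p) p p c → c ∈ supportedClasses X (2 * p) 1) :
    ∀ (m : ℕ) ⦃X : Motives.SchemeOver ℂ⦄, m ≤ N → Motives.IsSmoothProjective m X →
      ∀ (p : ℕ) (c : complexBetti X (2 * p)), IsRationalClass c →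
        IsOfHodgeType m X (2 * p) p p c → c ∈ algebraicClasses X p := by
  intro m
  induction m using Nat.strong_induction_on with
  | _ m ih =>
  intro X hmN hX p c hc hc'
  rcases Nat.eq_zero_or_pos p with rfl | hp
  · rw [algebraicClasses_zero]
    exact Submodule.mem_top
  -- coniveau one for `c`: automatic above the middle, Lefschetz `(1,1)` for `p = 1`, `h1` otherwise
  have hN1 : c ∈ supportedClasses X (2 * p) 1 := by
    rcases Nat.lt_or_ge m (2 * p) with hlt | hle
    · rw [soloInformed_supportedClasses_one_eq_top_of_lt hX hlt]
      exact Submodule.mem_top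
    · rcases (show p = 1 ∨ 2 ≤ p by omega) with rfl | hp2
      · exact hL hX c hc hc'
      · exact h1 hmN hX p c hp2 hle hc hc'
  -- `c` dies off one closed `Z` of codimension `≥ 1`, `Z ≠ X`
  obtain ⟨Z, hZ, hrZ, h0⟩ := exists_support_of_mem_supportedClasses hN1
  have hZ' : Z ≠ Set.univ :=
    soloInformed_ne_univ_of_one_le_coheight hX fun z hz ↦ by exact_mod_cast hrZ z hz
  -- Deligne 8.2.8 + lifting of Hodge classes: `c = Σ g_* b`, `b` rational Hodge on smaller `W`
  have hdec := mem_iSup_map_complexGysin_of_restrictCompl_eq_zero_of_ne_univ hA hB hH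
    complexOrientationFamily hasPoincareDuality_complexOrientationFamily hX hZ hZ' hc hc' h0
  -- every summand lies in `algebraicClasses X p`
  suffices hle : (⨆ (d : ℕ) (e : ℕ) (_ : d + e = p) (_ : 1 ≤ e) (W : Motives.SchemeOver ℂ) (m' : ℕ)
      (hm' : m' + e = m) (hW : Motives.IsSmoothProjective m' W) (g' : W ⟶ X),
      (Submodule.span ℂ {b : complexBetti W (2 * d) |
          IsRationalClass b ∧ IsOfHodgeType m' W (2 * d) d d b}).map
        (complexGysin complexOrientationFamily hW hX g'
          (show 2 * d + 2 * m = 2 * p + 2 * m' by omega))) ≤ algebraicClasses X p from hle hdec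
  refine iSup_le fun d ↦ iSup_le fun e ↦ iSup_le fun hde ↦ iSup_le fun he ↦ iSup_le fun W ↦
    iSup_le fun m' ↦ iSup_le fun hm' ↦ iSup_le fun hW ↦ iSup_le fun g' ↦ ?_
  subst hde
  refine le_trans (Submodule.map_mono ?_)
    (map_complexGysin_algebraicClasses_le hS complexOrientationFamily
      hasPoincareDuality_complexOrientationFamily hW hX g' hm')
  rw [Submodule.span_le]
  rintro b ⟨hb, hb'⟩
  exact ih m' (by omega) (by omega) hW d b hb hb'

/-! ### The equivalence with the summit statement -/

/-- **Coniveau one at and below the middle degree ⇒ the Hodge conjecture** (granted the named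
facts of `soloInformed_hodgeClasses_algebraic_of_coniveauOne` and the existence of Hodge models,
`nonempty_hodgeModel`, which supplies the anti-vacuity conjunct of `HodgeConjectureFor`).
[cite: GrothendieckTopology1969, pp. 300–301] [cite: DeligneHodgeIII1974, Cor. 8.2.8]
[cite: Voisin2025, Cor. 2.12] -/
theorem soloInformed_hodgeConjecture_of_coniveauOne
    (hA : Deligne1974_ker_restrictCompl_eq_iSup_range_complexGysin)
    (hB : Voisin2025_hodgeClass_lift_complexGysin)
    (hS : gysinMap_restrictCompl_eq_zero.{0, 0} ℂ)
    (hH : Resolution.Hironaka1964_projective.{0})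
    (hL : lefschetzOneOne_rational)
    (hM : ∀ (n : ℕ) (X : Motives.SchemeOver ℂ), nonempty_hodgeModel n X)
    (h1 : ∀ ⦃n : ℕ⦄ ⦃X : Motives.SchemeOver ℂ⦄, Motives.IsSmoothProjective n X →
      ∀ (p : ℕ) (c : complexBetti X (2 * p)), 2 ≤ p → 2 * p ≤ n → IsRationalClass c →
        IsOfHodgeType n X (2 * p) p p c → c ∈ supportedClasses X (2 * p) 1) :
    _root_.HodgeConjecture := by
  intro n X hX
  exact ⟨hM n X hX, soloInformed_hodgeClasses_algebraic_of_coniveauOne hA hB hS hH hL (N := n)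
    (fun m X _ hX' p c hp hpm hc hc' ↦ h1 hX' p c hp hpm hc hc') n le_rfl hX⟩

/-- **The Hodge conjecture is equivalent to coniveau one for rational Hodge classes at and below
the middle degree** — `HodgeConjecture ↔ ∀ n X p c, 2 ≤ p → 2p ≤ n → c rational of type (p,p) →
c ∈ N¹ H²ᵖ(X(ℂ); ℂ)` — granted the tree's named facts (Deligne 8.2.8; semisimplicity lift; Gysin
vs. restriction; projective Hironaka; Lefschetz `(1,1)`; existence of Hodge models).
[cite: GrothendieckTopology1969, pp. 300–301] [cite: Voisin2025, §2] [cite: Deligne2000, §1] -/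
theorem soloInformed_hodgeConjecture_iff_coniveauOne
    (hA : Deligne1974_ker_restrictCompl_eq_iSup_range_complexGysin)
    (hB : Voisin2025_hodgeClass_lift_complexGysin)
    (hS : gysinMap_restrictCompl_eq_zero.{0, 0} ℂ)
    (hH : Resolution.Hironaka1964_projective.{0})
    (hL : lefschetzOneOne_rational)
    (hM : ∀ (n : ℕ) (X : Motives.SchemeOver ℂ), nonempty_hodgeModel n X) :
    _root_.HodgeConjecture ↔
      ∀ ⦃n : ℕ⦄ ⦃X : Motives.SchemeOver ℂ⦄, Motives.IsSmoothProjective n X →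
        ∀ (p : ℕ) (c : complexBetti X (2 * p)), 2 ≤ p → 2 * p ≤ n → IsRationalClass c →
          IsOfHodgeType n X (2 * p) p p c → c ∈ supportedClasses X (2 * p) 1 :=
  ⟨fun h _ _ hX p c hp _ hc hc' ↦ soloInformed_coniveauOne_of_hodgeConjecture h hX p c (by omega) hc hc',
    soloInformed_hodgeConjecture_of_coniveauOne hA hB hS hH hL hM⟩

/-! ### Corollaries: dimension `≤ 3` for free, and the first open case `(n, p) = (4, 2)` -/

/-- **The Hodge conjecture (cycle part) in dimension `≤ 3`**, here from Deligne 8.2.8, the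
semisimplicity lift, Andreotti–Frankel and Lefschetz `(1,1)` — WITHOUT hard Lefschetz (the
hypothesis `C1(m, p)`, `2 ≤ p`, `2p ≤ m ≤ 3`, is empty). Compare the tree's named fact
`hodgeClasses_algebraic_of_dim_le_three` (Voisin II, proof of Prop. 10.26, via hard Lefschetz).
[cite: VoisinHodgeII2003, §10.2.3 proof of Prop. 10.26] -/
theorem soloInformed_hodgeClasses_algebraic_of_dim_le_three
    (hA : Deligne1974_ker_restrictCompl_eq_iSup_range_complexGysin)
    (hB : Voisin2025_hodgeClass_lift_complexGysin)
    (hS : gysinMap_restrictCompl_eq_zero.{0, 0} ℂ)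
    (hH : Resolution.Hironaka1964_projective.{0})
    (hL : lefschetzOneOne_rational) : hodgeClasses_algebraic_of_dim_le_three := by
  intro m X hm hX p c hc hc'
  exact soloInformed_hodgeClasses_algebraic_of_coniveauOne hA hB hS hH hL (N := 3)
    (fun m' X' hm' _ p' c' hp' hpm' _ _ ↦ by omega) m hm hX p c hc hc'

/-- **The first open case.** Granted the named facts, the Hodge conjecture (cycle part) for ALL
smooth complex projective varieties of dimension `≤ 4`, in all degrees, is equivalent to the single
statement `C1(4, 2)`: *every rational `(2,2)`-class on a smooth projective fourfold vanishes on the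
complex points of the complement of some divisor* (i.e. dies at the generic point).
[cite: GrothendieckTopology1969, pp. 300–301] [cite: Voisin2025, §2] -/
theorem soloInformed_hodgeClasses_algebraic_dim_le_four_iff_coniveauOne_two_two
    (hA : Deligne1974_ker_restrictCompl_eq_iSup_range_complexGysin)
    (hB : Voisin2025_hodgeClass_lift_complexGysin)
    (hS : gysinMap_restrictCompl_eq_zero.{0, 0} ℂ)
    (hH : Resolution.Hironaka1964_projective.{0})
    (hL : lefschetzOneOne_rational) :
    (∀ ⦃n : ℕ⦄ ⦃X : Motives.SchemeOver ℂ⦄, n ≤ 4 → Motives.IsSmoothProjective n X →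
        ∀ (p : ℕ) (c : complexBetti X (2 * p)), IsRationalClass c →
          IsOfHodgeType n X (2 * p) p p c → c ∈ algebraicClasses X p) ↔
      ∀ ⦃X : Motives.SchemeOver ℂ⦄, Motives.IsSmoothProjective 4 X →
        ∀ c : complexBetti X (2 * 2), IsRationalClass c → IsOfHodgeType 4 X (2 * 2) 2 2 c →
          c ∈ supportedClasses X (2 * 2) 1 := by
  refine ⟨fun h X hX c hc hc' ↦ supportedClasses_mono X (2 * 2) (by norm_num) (h le_rfl hX 2 c hc hc'),
    fun h n X hn hX p c hc hc' ↦ ?_⟩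
  refine soloInformed_hodgeClasses_algebraic_of_coniveauOne hA hB hS hH hL (N := 4) ?_ n hn hX p c hc hc'
  intro m X' hm hX' p' c' hp' hpm' hc₁ hc₂
  obtain rfl : p' = 2 := by omega
  obtain rfl : m = 4 := by omega
  exact h hX' c' hc₁ hc₂

end Summit.HodgeConjecture.HodgeConjecture.Theorems

end
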